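import Summits.NavierStokesRegularity.NavierStokesRegularity.Theorems.StrainDoorsDefs
import Summits.NavierStokesRegularity.NavierStokesRegularity.Theorems.StrainDoorsAlmostMax
import Summits.NavierStokesRegularity.NavierStokesRegularity.Theorems.StrainDoorsThresholdAlmost
import Literature.Analysis.FluidPDE.NSCriticalClosureTao
import HarnessLib

/-!
# StrainDoorsAlmostDefs — door family S37 «StrainDoors», the ALMOST-MAXIMISER TWINS H♭/Π♭: texts of record
# (§0♭–§4♭ of nsreg-p1 g31's `r35/Sketch37b.lean` sha16 d674839b8ebfbacc, l.265–388 VERBATIM)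

`IsStrainAlmostArgmax`, doors `StrainFeedingDoorAlmost` (H♭) / `PressureFocusingDoorAlmost` (Π♭), plates `StrainGrowthWeighted`
(E1_S♭), `StrainThresholdAlmost` (E2_S♭), `StrainThresholdAlmostLinear` (E2_S♭-lin).  The sketch's l.1–263 are the verbatim
Sketch37 block already in the tree (`…StrainDoorsDefs` / `…StrainDoorsCompositions` / `…StrainDoorsCompositionsB`); the
compositions §6♭–§8♭ land in `Theorems/StrainDoorsAlmostCompositions.lean`.  Landed by ns-s29-p2 g4 on LEAD ns-s30-p1 g3's
key 2026-08-28T18:53:38Z (c), `--kind definition`, `--supports stmt-NavierStokesRegularity-0056 --as helper`.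

HONEST FRAME: regularity CRITERIA charged at all `(1−δ)`-almost maximisers of the strain quotient of a hypothetical
blow-up; item 0056 `NoTypeII` and NS regularity are NOT proved; nothing here is a route or a summit statement.
-/

noncomputable section

open MeasureTheory Set Function Filter Metric Real InnerProductSpace
open _root_.Topology
open scoped ENNReal NNReal RealInnerProductSpace ContDiff Laplacian
open Literature.Analysis Literature.Analysis.FluidPDE
open Literature.Analysis.FluidPDE.VorticityDirectionDynamics

set_option linter.dupNamespace false

namespace Summit.NavierStokesRegularity.NavierStokesRegularity.Theorems.StrainDoors

open Summit.NavierStokesRegularity.NavierStokesRegularity.Theorems.ArgmaxDoors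

-- nested operator types (second derivatives)
set_option maxSynthPendingDepth 3
/-! ## §0♭ Almost / penalised maximisers of the strain quotient -/

/-- support (definition): `(x,e)` is a `(1−δ)`-ALMOST MAXIMISER of the strain quotient at time `t`: `|e| = 1` and
`(1−δ)⟪∇u(t,y)e′,e′⟫ ≤ ⟪∇u(t,x)e,e⟫` for every `y` and every unit `e′` (i.e. `⟪∇u e,e⟫ ≥ (1−δ)Λ(t)`). -/
def IsStrainAlmostArgmax (δ : ℝ) (u : ℝ → (EuclideanSpace ℝ (Fin 3)) → (EuclideanSpace ℝ (Fin 3))) (t : ℝ)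
    (x e : EuclideanSpace ℝ (Fin 3)) : Prop :=
  ‖e‖ = 1 ∧ ∀ (y e' : EuclideanSpace ℝ (Fin 3)), ‖e'‖ = 1 → (1 - δ) * strainQuad u t y e' ≤ strainQuad u t x e

/-! ## §2♭ Door S37-H♭ «StrainFeedingDoorAlmost» -/

/-- door S37-H♭ «StrainFeedingDoorAlmost» (regularity criterion; the almost-maximiser twin of door S37-H).
`ν > 0`, `0 ≤ t₀ < T`, `0 < y₀ < 1`, `c < y₀(1+y₀)`, `0 < δ < 1`, `(u,p)` in the frame. HYPOTHESIS, charged at every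
`(1−δ)`-ALMOST MAXIMISER `(x,e)` of the strain quotient at times `t ∈ [t₀,T)` with `(T−t)⟪∇u(t,x)e,e⟫ > y₀`:
the dimensionless strain feed obeys `(T−t)²·(¼(|ω|² − ⟪ω,e⟫²) − ∇²p(e,e))(t,x) ≤ c`. CONCLUSION: extension past
`T`. Closes WITHOUT any spatial-decay plate (`strainFeedingDoorAlmost_of_plates`). -/
def StrainFeedingDoorAlmost : Prop :=
  ∀ (ν T t₀ y₀ c δ : ℝ), 0 < ν → 0 ≤ t₀ → t₀ < T → 0 < y₀ → y₀ < 1 → c < y₀ * (1 + y₀) → 0 < δ → δ < 1 →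
    ∀ (u : ℝ → (EuclideanSpace ℝ (Fin 3)) → (EuclideanSpace ℝ (Fin 3)))
      (p : ℝ → (EuclideanSpace ℝ (Fin 3)) → ℝ),
      IsClassicalNSSolutionOn (Ico 0 T) ν 0 u p →
      (∀ T'' < T, HasBoundedSobolevNormsOn (Icc 0 T'') u) →
      (∀ t ∈ Ico t₀ T, ∀ (x e : EuclideanSpace ℝ (Fin 3)), IsStrainAlmostArgmax δ u t x e →
        y₀ < (T - t) * strainQuad u t x e →
        (T - t) ^ 2 * strainFeed u p t x e ≤ c) →
      HasSobolevExtensionPast ν u T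

/-! ## §3♭ Door S37-Π♭ «PressureFocusingDoorAlmost» -/

/-- door S37-Π♭ «PressureFocusingDoorAlmost» (regularity criterion; door H♭ through the pressure Poisson equation):
at every charged `(1−δ)`-almost maximiser,
`(T−t)²·(⅓|S|² + (1/12)|ω|² − ¼⟪ω,e⟫² − Π(e,e))(t,x) ≤ c`, `Π = deviatoricHessian p(t)` ⇒ extension. -/
def PressureFocusingDoorAlmost : Prop :=
  ∀ (ν T t₀ y₀ c δ : ℝ), 0 < ν → 0 ≤ t₀ → t₀ < T → 0 < y₀ → y₀ < 1 → c < y₀ * (1 + y₀) → 0 < δ → δ < 1 →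
    ∀ (u : ℝ → (EuclideanSpace ℝ (Fin 3)) → (EuclideanSpace ℝ (Fin 3)))
      (p : ℝ → (EuclideanSpace ℝ (Fin 3)) → ℝ),
      IsClassicalNSSolutionOn (Ico 0 T) ν 0 u p →
      (∀ T'' < T, HasBoundedSobolevNormsOn (Icc 0 T'') u) →
      (∀ t ∈ Ico t₀ T, ∀ (x e : EuclideanSpace ℝ (Fin 3)), IsStrainAlmostArgmax δ u t x e →
        y₀ < (T - t) * strainQuad u t x e →
        (T - t) ^ 2 * ((1 / 3) * strainNormSq u t x + (1 / 12) * ‖curl (u t) x‖ ^ 2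
            - (1 / 4) * ⟪curl (u t) x, e⟫ ^ 2 - devPressureHess p t x e) ≤ c) →
      HasSobolevExtensionPast ν u T

/-! ## §4♭ Plates -/

/-- plate E1_S♭ «StrainGrowthWeighted» (M; PDE-free vector calculus at a WEIGHTED maximum). `ν ≥ 0`, `ε > 0`, `v`
smooth, `q` any scalar field, `|e₀| = 1`, `x₀` a global maximum point of `y ↦ (1 + ε|y|²)⁻¹⟪∇v(y)e₀,e₀⟫` with
`q₀ := ⟪∇v(x₀)e₀,e₀⟫ ≥ 0`, `w` any vector with `w + D((v·∇)v)(x₀)e₀ = νD(Δv)(x₀)e₀ − D(∇q)(x₀)e₀`. Then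
`⟪w,e₀⟫ ≤ −q₀² + ¼(|curl v(x₀)|² − ⟪curl v(x₀),e₀⟫²) − ⟪D(∇q)(x₀)e₀,e₀⟫ + (6νε + √ε|v(x₀)|)·q₀`.
(With `g = 1+ε|y|²`, `Q(y) = ⟪∇v(y)e₀,e₀⟫`: Fermat for `Q/g` gives `∇Q(x₀) = q₀∇g/g`, so the transport term is
`(v·∇)Q(x₀) = 2εq₀⟪x₀,v(x₀)⟫/g(x₀)`, `|·| ≤ √ε|v(x₀)|q₀`; `Δ(Q/g)(x₀) ≤ 0` gives `ΔQ(x₀) ≤ q₀Δg/g = 6εq₀/g(x₀)`;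
the matrix term is E1_S's `⟪A²e₀,e₀⟫ ≥ q₀² − ¼|ω×e₀|²`.) -/
def StrainGrowthWeighted : Prop :=
  ∀ (ν ε : ℝ), 0 ≤ ν → 0 < ε →
    ∀ (v : (EuclideanSpace ℝ (Fin 3)) → (EuclideanSpace ℝ (Fin 3))) (q : (EuclideanSpace ℝ (Fin 3)) → ℝ),
      ContDiff ℝ ∞ v →
      ∀ (x₀ e₀ : EuclideanSpace ℝ (Fin 3)), ‖e₀‖ = 1 →
        (∀ y : EuclideanSpace ℝ (Fin 3),
          (1 + ε * ‖y‖ ^ 2)⁻¹ * ⟪fderiv ℝ v y e₀, e₀⟫ ≤ (1 + ε * ‖x₀‖ ^ 2)⁻¹ * ⟪fderiv ℝ v x₀ e₀, e₀⟫) →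
        0 ≤ ⟪fderiv ℝ v x₀ e₀, e₀⟫ →
        ∀ w : EuclideanSpace ℝ (Fin 3),
          w + fderiv ℝ (convect v v) x₀ e₀ = ν • fderiv ℝ (Δ v) x₀ e₀ - fderiv ℝ (gradient q) x₀ e₀ →
          ⟪w, e₀⟫ ≤ -⟪fderiv ℝ v x₀ e₀, e₀⟫ ^ 2 + (1 / 4) * (‖curl v x₀‖ ^ 2 - ⟪curl v x₀, e₀⟫ ^ 2) -
            ⟪fderiv ℝ (gradient q) x₀ e₀, e₀⟫ +
            (6 * ν * ε + Real.sqrt ε * ‖v x₀‖) * ⟪fderiv ℝ v x₀ e₀, e₀⟫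

/-- plate E2_S♭ «StrainThresholdAlmost» (S over E2_S♭-lin; RICCATI first-touch comparison charged at penalised
almost-maximisers, NO decay; binder order of the landed p658095). In the frame, on a slab `[t₁,t₂] ⊂ [0,T)`;
`0 < δ < 1`; an allowance `η` with `η(ε) → 0` (`ε ↓ 0`); `B > 0` continuous with `B' ≥ −B² + h` within `[t₁,t₂]`,
`h ≥ 0`. Suppose for every `0 < ε ≤ 1`, every `t ∈ (t₁,t₂]` and every `(x,e)`, `|e| = 1`, that is a PENALISED
maximiser (`(1+ε|y|²)⁻¹⟪∇u(t,y)e′,e′⟫ ≤ (1+ε|x|²)⁻¹⟪∇u(t,x)e,e⟫` for all `y`, unit `e′`) AND a `(1−δ)`-almost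
maximiser with `⟪∇u e,e⟫ > B(t)`: `∂ₜ⟪∇u e,e⟫ ≤ −⟪∇u e,e⟫² + h(t) + η(ε)⟪∇u e,e⟫`. If `⟪∇u(t₁)e,e⟫ ≤ B(t₁)` for
all `x`, unit `e`, then `⟪∇u(t,x)e,e⟫ ≤ B(t)` on the slab. CLOSED below from E2_S♭-lin (`strainThresholdAlmost_of`). -/
def StrainThresholdAlmost : Prop :=
  ∀ (ν T t₁ t₂ δ : ℝ) (η : ℝ → ℝ), 0 < ν → 0 ≤ t₁ → t₁ < t₂ → t₂ < T → 0 < δ → δ < 1 →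
    Tendsto η (𝓝[>] 0) (𝓝 0) →
    ∀ (u : ℝ → (EuclideanSpace ℝ (Fin 3)) → (EuclideanSpace ℝ (Fin 3)))
      (p : ℝ → (EuclideanSpace ℝ (Fin 3)) → ℝ),
      IsClassicalNSSolutionOn (Ico 0 T) ν 0 u p →
      (∀ T'' < T, HasBoundedSobolevNormsOn (Icc 0 T'') u) →
      ∀ (B B' h : ℝ → ℝ), ContinuousOn B (Icc t₁ t₂) → (∀ t ∈ Icc t₁ t₂, 0 < B t) →
        (∀ t ∈ Icc t₁ t₂, HasDerivWithinAt B (B' t) (Icc t₁ t₂) t) →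
        (∀ t ∈ Icc t₁ t₂, -(B t) ^ 2 + h t ≤ B' t) → (∀ t ∈ Icc t₁ t₂, 0 ≤ h t) →
        (∀ ε : ℝ, 0 < ε → ε ≤ 1 → ∀ t ∈ Ioc t₁ t₂, ∀ (x e : EuclideanSpace ℝ (Fin 3)), ‖e‖ = 1 →
          (∀ (y e' : EuclideanSpace ℝ (Fin 3)), ‖e'‖ = 1 →
            (1 + ε * ‖y‖ ^ 2)⁻¹ * strainQuad u t y e' ≤ (1 + ε * ‖x‖ ^ 2)⁻¹ * strainQuad u t x e) →
          (∀ (y e' : EuclideanSpace ℝ (Fin 3)), ‖e'‖ = 1 → (1 - δ) * strainQuad u t y e' ≤ strainQuad u t x e) →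
          B t < strainQuad u t x e →
          strainRate T u t x e ≤ -(strainQuad u t x e) ^ 2 + h t + η ε * strainQuad u t x e) →
        (∀ (x e : EuclideanSpace ℝ (Fin 3)), ‖e‖ = 1 → strainQuad u t₁ x e ≤ B t₁) →
        ∀ t ∈ Icc t₁ t₂, ∀ (x e : EuclideanSpace ℝ (Fin 3)), ‖e‖ = 1 → strainQuad u t x e ≤ B t

/-- plate E2_S♭-lin «StrainThresholdAlmostLinear» (S; THE TEXT OF THE LANDED p658095
`ArgmaxDoors.strainThresholdAlmost`, `Theorems/StrainDoorsThresholdAlmost.lean`, LEAD S-door ns-s30-p1 g3 — the NS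
instance of the device p657155 `ArgmaxDoors.rayleigh_le_supersolution_of_almostArgmax_growth`; binders in its
order, `strainQuad`/`strainRate` unfold to its terms by `rfl`). Same slab data with LINEAR growth
`∂ₜ⟪∇u e,e⟫ ≤ (φ(t) + η(ε))⟪∇u e,e⟫` at the charged penalised almost-maximisers and `φB ≤ B'`; NO decay hypothesis.
CLOSED below BY NAME (`strainThresholdAlmostLinear_holds`). -/
def StrainThresholdAlmostLinear : Prop :=
  ∀ (ν T t₁ t₂ δ : ℝ) (η : ℝ → ℝ), 0 < ν → 0 ≤ t₁ → t₁ < t₂ → t₂ < T → 0 < δ → δ < 1 →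
    Tendsto η (𝓝[>] 0) (𝓝 0) →
    ∀ (u : ℝ → (EuclideanSpace ℝ (Fin 3)) → (EuclideanSpace ℝ (Fin 3)))
      (p : ℝ → (EuclideanSpace ℝ (Fin 3)) → ℝ),
      IsClassicalNSSolutionOn (Ico 0 T) ν 0 u p →
      (∀ T'' < T, HasBoundedSobolevNormsOn (Icc 0 T'') u) →
      ∀ (B B' φ : ℝ → ℝ), ContinuousOn B (Icc t₁ t₂) → (∀ t ∈ Icc t₁ t₂, 0 < B t) →
        (∀ t ∈ Icc t₁ t₂, HasDerivWithinAt B (B' t) (Icc t₁ t₂) t) →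
        (∀ t ∈ Icc t₁ t₂, φ t * B t ≤ B' t) →
        (∀ ε : ℝ, 0 < ε → ε ≤ 1 → ∀ t ∈ Ioc t₁ t₂, ∀ (x e : EuclideanSpace ℝ (Fin 3)), ‖e‖ = 1 →
          (∀ (y e' : EuclideanSpace ℝ (Fin 3)), ‖e'‖ = 1 →
            (1 + ε * ‖y‖ ^ 2)⁻¹ * strainQuad u t y e' ≤ (1 + ε * ‖x‖ ^ 2)⁻¹ * strainQuad u t x e) →
          (∀ (y e' : EuclideanSpace ℝ (Fin 3)), ‖e'‖ = 1 → (1 - δ) * strainQuad u t y e' ≤ strainQuad u t x e) →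
          B t < strainQuad u t x e →
          strainRate T u t x e ≤ (φ t + η ε) * strainQuad u t x e) →
        (∀ (x e : EuclideanSpace ℝ (Fin 3)), ‖e‖ = 1 → strainQuad u t₁ x e ≤ B t₁) →
        ∀ t ∈ Icc t₁ t₂, ∀ (x e : EuclideanSpace ℝ (Fin 3)), ‖e‖ = 1 → strainQuad u t x e ≤ B t

end Summit.NavierStokesRegularity.NavierStokesRegularity.Theorems.StrainDoors

end
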